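import Mathlib
import Summits.CriticalPhenomena.PercolationContinuityZ3.Theorems.PercNearOneGluingAdditiveGluingPocketBHKPrelim
import HarnessLib

/-! # Crux `PercNearOneGluing.AdditiveGluing` (stmt-CriticalPhenomena-4576), line `subuniform-dead-pocket-maximum`,
# stub `stub_goodStep` — the pocket-augmented BHK inequality, II: conditioning step and base case

Helper file for the crux (prover-siege k9).  Continues `…PocketBHKPrelim.lean` (notation there) with the two
ingredients of the pocket-augmented van den Berg–Häggström–Kahn inequality (`…PocketBHK.lean`, `pocketCore`)
for the pocket event `F = {o ↔ s} ∪ {C(o) ∈ P}`: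
* `step_sumF` — BHK's conditioning identity (6) (doi:10.1002/rsa.20102 p. 4) for the pocket factor:
  conditioning on the set `S` of vertices attached to `Z` turns `1_F · H(C_s) · 1{s ↮ W}` (`W ⊇ Z`, pockets
  avoiding `Z`) into the same expression in `G[U ∖ Z]` with the pocket family SHRUNK to the pockets disjoint
  from `S` (`rF_restrict_iff`) — which is antitone in `S`, exactly what the Ahlswede–Daykin step needs;
* `disj0` — the NEW base case `X ∩ Y = ∅`: `E[1_F 1_{R_X}] · E[G(C_s)] ≤ E[1_F G(C_s)] · P(R_X)` for EVERY
  predicate `P` and increasing `G ≥ 0` (no Harris inequality is available for the non-monotone `F`).  Proof: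
  expand along `1 = 1{o↔s} + Σ_W 1{C(o)=W}`; by the spatial Markov property (`pocket_sum`) the `W`-term of
  `E[1_F 1_{R_X}]E[G] − E[1_F G]E[R_X]` is `P(C(o)=W)·(E_{U∖W}[R_X]E[G] − E_{U∖W}[G]E[R_X]) ≥ 0` (deleting `W`
  helps the decreasing `R_X` and hurts the increasing `G`), the COMPLETE sum (all pockets and the
  `{o↔s}`-term) vanishes identically, so the partial sum over the pockets in `P` is `≤ 0`.
Registered sub-goal of this file: `stub_pocketDisjoint_k9` (= `disj0`). No definitions. -/

namespace Summit.CriticalPhenomena.PercolationContinuityZ3.Theorems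

namespace PocketBHK

open Literature.Probability.Percolation Literature.Probability.Percolation.BHK2006
open DecisionTree (ind ind_of_mem ind_of_not_mem ind_nonneg)
open scoped Classical

noncomputable section

variable {V : Type*}

/-! ### BHK's conditioning identity (6) for the pocket factor -/

/-- **Restriction of the pocket event** (the pocket analogue of BHK's (6)).  Let `Z ⊆ U`, `o, s ∉ Z`, and
let `P` hold only on sets avoiding `Z`.  If `s` is joined in `G[U ∖ Z]` to no vertex of BHK's set
`S = rS U Z ω`, then `ω ∈ F_U(P)` iff `ω ∈ F_{U∖Z}(P ∧ Disjoint · S)` — an open `o–s` path avoids `Z`, and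
`C_U(o) = W` with `W ∩ Z = ∅` iff `C_{U∖Z}(o) = W` and no vertex of `W` has an open edge into `Z`.
[folklore] -/
theorem rF_restrict_iff {U Z : Finset V} (hZU : Z ⊆ U) {o s : V} (ho : o ∉ Z) (hs : s ∉ Z)
    {P : Set V → Prop} (hPZ : ∀ K, P K → ∀ z ∈ Z, z ∉ K) {ω : Set (Sym2 V)}
    (hS : ∀ n ∈ rS U Z ω, ¬ (openGraph (ω ∩ edgesIn (U \ Z))).Reachable s n) :
    ω ∈ {ξ | (openGraph (ξ ∩ edgesIn U)).Reachable o s ∨ P (openCluster (ξ ∩ edgesIn U) o)} ↔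
      ω ∈ {ξ | (openGraph (ξ ∩ edgesIn (U \ Z))).Reachable o s ∨
        (P (openCluster (ξ ∩ edgesIn (U \ Z)) o) ∧ Disjoint (openCluster (ξ ∩ edgesIn (U \ Z)) o) (rS U Z ω))} := by
  have hmono : ∀ v, (openGraph (ω ∩ edgesIn (U \ Z))).Reachable o v →
      (openGraph (ω ∩ edgesIn U)).Reachable o v := fun v hv =>
    hv.mono (openGraph_le (Set.inter_subset_inter_right _ (edgesIn_mono Finset.sdiff_subset)))
  constructor
  · rintro (hr | hP)
    · -- an open `o–s` path avoids `Z`: restrict the reversed path from `s`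
      exact Or.inl ((reach_restrict hs hS hr.symm).2.symm)
    · right
      have hKZ : ∀ z ∈ Z, z ∉ openCluster (ω ∩ edgesIn U) o := hPZ _ hP
      -- the cluster of `o` avoids `Z`, hence is its cluster in `G[U ∖ Z]`
      have hK : openCluster (ω ∩ edgesIn U) o = openCluster (ω ∩ edgesIn (U \ Z)) o := by
        refine Set.Subset.antisymm (fun v hv => ?_) (fun v hv => hmono v hv)
        change (openGraph (ω ∩ edgesIn U)).Reachable o v at hv
        rw [SimpleGraph.reachable_iff_reflTransGen] at hv
        induction hv with
        | refl => exact mem_openCluster_self _ o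
        | @tail b c hob hbc ih =>
          have hbK : b ∈ openCluster (ω ∩ edgesIn U) o :=
            (SimpleGraph.reachable_iff_reflTransGen _ _).2 hob
          have hcK : c ∈ openCluster (ω ∩ edgesIn U) o := hbK.trans hbc.reachable
          obtain ⟨hω', ⟨hbU, hcU⟩, hne⟩ := adj_iff.1 hbc
          have hbZ : b ∉ Z := fun h => hKZ b h hbK
          have hcZ : c ∉ Z := fun h => hKZ c h hcK
          exact SimpleGraph.Reachable.trans ih (SimpleGraph.Adj.reachable (adj_iff.2
            ⟨hω', ⟨Finset.mem_sdiff.2 ⟨hbU, hbZ⟩, Finset.mem_sdiff.2 ⟨hcU, hcZ⟩⟩, hne⟩))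
      refine ⟨hK ▸ hP, Set.disjoint_left.2 fun n hnK hnS => ?_⟩
      obtain ⟨hn, z, hz, hnz⟩ := hnS
      obtain ⟨hnU, hnZ⟩ := Finset.mem_sdiff.1 hn
      have hnK' : n ∈ openCluster (ω ∩ edgesIn U) o := hK.symm ▸ hnK
      have hadj : (openGraph (ω ∩ edgesIn U)).Adj n z := by
        refine adj_iff.2 ⟨hnz, ⟨hnU, hZU hz⟩, ?_⟩
        rintro rfl
        exact hnZ hz
      exact hKZ z hz (hnK'.trans hadj.reachable)
  · rintro (hr | ⟨hP, hdisj⟩)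
    · exact Or.inl (hmono s hr)
    · right
      have hS' : ∀ n ∈ rS U Z ω, ¬ (openGraph (ω ∩ edgesIn (U \ Z))).Reachable o n :=
        fun n hn hr => Set.disjoint_left.1 hdisj hr hn
      have hK : openCluster (ω ∩ edgesIn U) o = openCluster (ω ∩ edgesIn (U \ Z)) o :=
        Set.Subset.antisymm (fun v hv => (reach_restrict ho hS' hv).2) (fun v hv => hmono v hv)
      exact hK ▸ hP

/-- The pocket factor shrinks with the forbidden set:
`T ⊆ T' → 1_{F(P ∧ Disjoint · T')} ≤ 1_{F(P ∧ Disjoint · T)}`. [folklore] -/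
theorem ind_rF_disjoint_anti (U' : Finset V) (o s : V) (P : Set V → Prop) {T T' : Set V} (h : T ⊆ T')
    (ω : Set (Sym2 V)) :
    ind {ξ | (openGraph (ξ ∩ edgesIn U')).Reachable o s ∨
        (P (openCluster (ξ ∩ edgesIn U') o) ∧ Disjoint (openCluster (ξ ∩ edgesIn U') o) T')} ω ≤
      ind {ξ | (openGraph (ξ ∩ edgesIn U')).Reachable o s ∨
        (P (openCluster (ξ ∩ edgesIn U') o) ∧ Disjoint (openCluster (ξ ∩ edgesIn U') o) T)} ω := by
  refine ind_mono (fun ω hω => ?_) ω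
  rcases hω with hr | ⟨hP, hd⟩
  · exact Or.inl hr
  · exact Or.inr ⟨hP, hd.mono_right h⟩

variable [Fintype V]

/-- **BHK's (6) with the pocket factor**: for `Z ⊆ W`, `o, s ∉ Z` and pockets avoiding `Z`,
`E[1_F · H(C_s^U) · 1{s ↮ W in G[U]}]` is the average over `S = S(ω)` of the `G[U ∖ Z]`-expectation
`E'[1_{F(P ∧ Disjoint · S)} · H(C_s^{U∖Z}) · 1{s ↮ (W ∖ Z) ∪ S}]`.
[cite: VandenbergHaggstromKahn2005, §1 p. 4, identity (6)] -/
theorem step_sumF {U Z : Finset V} (hZU : Z ⊆ U) {o s : V} (ho : o ∉ Z) (hs : s ∉ Z) {W : Set V}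
    (hZW : (↑Z : Set V) ⊆ W) {P : Set V → Prop} (hPZ : ∀ K, P K → ∀ z ∈ Z, z ∉ K)
    (w : Sym2 V → ℝ) (hm : ∑ ω, weight w ω = 1) (H : Set (Sym2 V) → ℝ) :
    ∑ ω, weight w ω * (ind {ξ | (openGraph (ξ ∩ edgesIn U)).Reachable o s ∨
        P (openCluster (ξ ∩ edgesIn U) o)} ω * H (rC U s ω) * ind (rD U s W) ω) =
      ∑ ω, weight w ω * ∑ η, weight w η *
        (ind {ξ | (openGraph (ξ ∩ edgesIn (U \ Z))).Reachable o s ∨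
            (P (openCluster (ξ ∩ edgesIn (U \ Z)) o) ∧
              Disjoint (openCluster (ξ ∩ edgesIn (U \ Z)) o) (rS U Z ω))} η *
          H (rC (U \ Z) s η) * ind (rD (U \ Z) s ((W \ ↑Z) ∪ rS U Z ω)) η) := by
  set F : Set (Set (Sym2 V)) :=
    {ξ | (openGraph (ξ ∩ edgesIn U)).Reachable o s ∨ P (openCluster (ξ ∩ edgesIn U) o)} with hF
  set F' : Set V → Set (Set (Sym2 V)) := fun T =>
    {ξ | (openGraph (ξ ∩ edgesIn (U \ Z))).Reachable o s ∨
      (P (openCluster (ξ ∩ edgesIn (U \ Z)) o) ∧ Disjoint (openCluster (ξ ∩ edgesIn (U \ Z)) o) T)}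
    with hF'
  set A := meeting Z with hA
  set Φ : Set (Sym2 V) → Set (Sym2 V) → ℝ := fun ζ η =>
    ind (F' (rS U Z ζ)) η * H (rC (U \ Z) s η) * ind (rD (U \ Z) s ((W \ ↑Z) ∪ rS U Z ζ)) η with hΦ
  have hFd : ∀ (T : Set V) (η : Set (Sym2 V)), η \ meeting Z ∈ F' T ↔ η ∈ F' T := by
    intro T η
    simp only [hF', Set.mem_setOf_eq, diff_meeting_inter_edgesIn, openCluster]
  have hFd' : ∀ (T : Set V) (η : Set (Sym2 V)), ind (F' T) (η \ meeting Z) = ind (F' T) η := by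
    intro T η
    by_cases hη : η ∈ F' T
    · rw [ind_of_mem hη, ind_of_mem ((hFd T η).2 hη)]
    · rw [ind_of_not_mem hη, ind_of_not_mem (fun h' => hη ((hFd T η).1 h'))]
  have hDd : ∀ (T : Set V) (η : Set (Sym2 V)),
      ind (rD (U \ Z) s ((W \ ↑Z) ∪ T)) (η \ meeting Z) = ind (rD (U \ Z) s ((W \ ↑Z) ∪ T)) η := by
    intro T η
    by_cases hη : η ∈ rD (U \ Z) s ((W \ ↑Z) ∪ T)
    · rw [ind_of_mem hη, ind_of_mem ((mem_rD_diff_meeting U Z s _ η).2 hη)]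
    · rw [ind_of_not_mem hη, ind_of_not_mem (fun h => hη ((mem_rD_diff_meeting U Z s _ η).1 h))]
  have h1 : ∀ ω, ind F ω * H (rC U s ω) * ind (rD U s W) ω = Φ (ω ∩ A) (ω \ A) := by
    intro ω
    show _ = ind (F' (rS U Z (ω ∩ A))) (ω \ A) * H (rC (U \ Z) s (ω \ A)) *
      ind (rD (U \ Z) s ((W \ ↑Z) ∪ rS U Z (ω ∩ A))) (ω \ A)
    rw [hA, rS_inter_meeting, rC_diff_meeting, hFd', hDd]
    by_cases hω : ω ∈ rD U s W
    · have hω' := (mem_rD_iff_restrict hZU hs hZW ω).1 hω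
      have hS : ∀ n ∈ rS U Z ω, ¬ (openGraph (ω ∩ edgesIn (U \ Z))).Reachable s n :=
        fun n hn => hω' n (Or.inr hn)
      rw [ind_of_mem hω, ind_of_mem hω', rC_restrict hs hS]
      by_cases hFω : ω ∈ F
      · rw [ind_of_mem hFω, ind_of_mem ((rF_restrict_iff hZU ho hs hPZ hS).1 hFω)]
      · rw [ind_of_not_mem hFω, ind_of_not_mem (fun h' => hFω ((rF_restrict_iff hZU ho hs hPZ hS).2 h'))]
    · have hω' : ω ∉ rD (U \ Z) s ((W \ ↑Z) ∪ rS U Z ω) := fun h =>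
        hω ((mem_rD_iff_restrict hZU hs hZW ω).2 h)
      rw [ind_of_not_mem hω, ind_of_not_mem hω', mul_zero, mul_zero]
  have h2 : ∀ ω η, Φ (ω ∩ A) (η \ A) =
      ind (F' (rS U Z ω)) η * H (rC (U \ Z) s η) * ind (rD (U \ Z) s ((W \ ↑Z) ∪ rS U Z ω)) η := by
    intro ω η
    show ind (F' (rS U Z (ω ∩ A))) (η \ A) * H (rC (U \ Z) s (η \ A)) *
      ind (rD (U \ Z) s ((W \ ↑Z) ∪ rS U Z (ω ∩ A))) (η \ A) = _
    rw [hA, rS_inter_meeting, rC_diff_meeting, hFd', hDd]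
  calc ∑ ω, weight w ω * (ind F ω * H (rC U s ω) * ind (rD U s W) ω)
      = (∑ ω, weight w ω) * ∑ ω, weight w ω * Φ (ω ∩ A) (ω \ A) := by
        rw [hm, one_mul]; simp_rw [h1]
    _ = ∑ ω, weight w ω * ∑ ω', weight w ω' * Φ (ω ∩ A) (ω' \ A) := blockFubini w A Φ
    _ = _ := by simp_rw [h2]; rfl

/-! ### The base case `X ∩ Y = ∅` -/

/-- Expansion of `E[f]` along the partition `1 = 1{o ↔ s} + Σ_{W pocket} 1{C(o) = W}`. [folklore] -/
theorem sum_partition (w : Sym2 V → ℝ) {U : Finset V} {o : V} (hoU : o ∈ U) (s : V)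
    (f : Set (Sym2 V) → ℝ) :
    ∑ ω, weight w ω * f ω =
      ∑ ω, weight w ω * (ind {ω | (openGraph (ω ∩ edgesIn U)).Reachable o s} ω * f ω) +
        ∑ W ∈ (U.powerset.filter fun W => o ∈ W ∧ s ∉ W),
          ∑ ω, weight w ω * (ind {ω | openCluster (ω ∩ edgesIn U) o = ↑W} ω * f ω) := by
  rw [Finset.sum_comm, ← Finset.sum_add_distrib]
  refine Finset.sum_congr rfl fun ω _ => ?_
  rw [← Finset.mul_sum, ← mul_add, ← Finset.sum_mul, ← add_mul, ind_reach_add_sum_pockets hoU s ω,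
    one_mul]

/-- Expansion of `E[1_F f]` along the same partition: only the pockets in `P` survive. [folklore] -/
theorem sum_partition_rF (w : Sym2 V → ℝ) {U : Finset V} {o : V} (hoU : o ∈ U) (s : V)
    (P : Set V → Prop) (f : Set (Sym2 V) → ℝ) :
    ∑ ω, weight w ω * (ind {ξ | (openGraph (ξ ∩ edgesIn U)).Reachable o s ∨
        P (openCluster (ξ ∩ edgesIn U) o)} ω * f ω) =
      ∑ ω, weight w ω * (ind {ω | (openGraph (ω ∩ edgesIn U)).Reachable o s} ω * f ω) +
        ∑ W ∈ (U.powerset.filter fun W => o ∈ W ∧ s ∉ W).filter (fun W : Finset V => P (↑W : Set V)),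
          ∑ ω, weight w ω * (ind {ω | openCluster (ω ∩ edgesIn U) o = ↑W} ω * f ω) := by
  rw [Finset.sum_comm, ← Finset.sum_add_distrib]
  refine Finset.sum_congr rfl fun ω _ => ?_
  rw [← Finset.mul_sum, ← mul_add, ← Finset.sum_mul, ← add_mul, ind_rF_eq hoU s P ω]

omit [Fintype V] in
/-- `1{s ↮ ∅} = 1`. [folklore] -/
theorem ind_rD_empty (U : Finset V) (s : V) (ω : Set (Sym2 V)) : ind (rD U s (∅ : Set V)) ω = 1 :=
  ind_of_mem fun x hx _ => (Set.notMem_empty x hx).elim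

omit [Fintype V] in
/-- A finite sum `Σ a·(x·M − g·N)` split into its two parts. [folklore] -/
theorem sum_mul_sub (S : Finset (Finset V)) (a x g : Finset V → ℝ) (M N : ℝ) :
    ∑ W ∈ S, a W * (x W * M - g W * N) = (∑ W ∈ S, a W * x W) * M - (∑ W ∈ S, a W * g W) * N := by
  rw [Finset.sum_mul, Finset.sum_mul, ← Finset.sum_sub_distrib]
  exact Finset.sum_congr rfl fun W _ => by ring

/-- **The base case `X ∩ Y = ∅` of the pocket-augmented BHK inequality** (new): for `o ∈ U`, every `X`,
every predicate `P` and every increasing `G ≥ 0`,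
`E[1_F 1{s ↮ X}] · E[G(C_s)] ≤ E[1_F G(C_s)] · P(s ↮ X)`, `F = {o ↔ s} ∪ {C(o) ∈ P}`.
See the module docstring for the proof. [folklore] -/
theorem disj0 (w : Sym2 V → ℝ) (hw0 : ∀ e, 0 ≤ w e) (hw1 : ∀ e, w e ≤ 1) (hm : ∑ ω, weight w ω = 1)
    {U : Finset V} {s o : V} (hoU : o ∈ U) (X : Set V) (P : Set V → Prop)
    (G : Set (Sym2 V) → ℝ) (hG : Monotone G) (hG0 : ∀ a, 0 ≤ G a) :
    (∑ ω, weight w ω * (ind {ξ | (openGraph (ξ ∩ edgesIn U)).Reachable o s ∨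
        P (openCluster (ξ ∩ edgesIn U) o)} ω * ind (rD U s X) ω)) *
      (∑ ω, weight w ω * G (rC U s ω)) ≤
    (∑ ω, weight w ω * (ind {ξ | (openGraph (ξ ∩ edgesIn U)).Reachable o s ∨
        P (openCluster (ξ ∩ edgesIn U) o)} ω * G (rC U s ω))) *
      (∑ ω, weight w ω * ind (rD U s X) ω) := by
  -- notation
  set Pk := (U.powerset.filter fun W => o ∈ W ∧ s ∉ W) with hPk
  set PkP := (U.powerset.filter fun W => o ∈ W ∧ s ∉ W).filter (fun W : Finset V => P (↑W : Set V))
    with hPkP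
  set a : Finset V → ℝ := fun W => ∑ ω, weight w ω * ind {ω | openCluster (ω ∩ edgesIn U) o = ↑W} ω
    with ha
  set x : Finset V → ℝ := fun W => ∑ η, weight w η * ind (rD (U \ W) s X) η with hx
  set g : Finset V → ℝ := fun W => ∑ η, weight w η * G (rC (U \ W) s η) with hg
  set MX := ∑ ω, weight w ω * ind (rD U s X) ω with hMX
  set MG := ∑ ω, weight w ω * G (rC U s ω) with hMG
  set ρ₁ := ∑ ω, weight w ω * (ind {ω | (openGraph (ω ∩ edgesIn U)).Reachable o s} ω * ind (rD U s X) ω)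
    with hρ₁
  set ρG := ∑ ω, weight w ω * (ind {ω | (openGraph (ω ∩ edgesIn U)).Reachable o s} ω * G (rC U s ω))
    with hρG
  -- the pocket terms, by the spatial Markov property
  have hterm_x : ∀ W ∈ Pk,
      ∑ ω, weight w ω * (ind {ω | openCluster (ω ∩ edgesIn U) o = ↑W} ω * ind (rD U s X) ω) = a W * x W := by
    intro W hW
    obtain ⟨-, -, hsW⟩ := mem_pockets.1 hW
    have := pocket_sum (U := U) (o := o) hsW w hm (fun _ => (1 : ℝ)) X
    simpa only [one_mul] using this
  have hterm_g : ∀ W ∈ Pk,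
      ∑ ω, weight w ω * (ind {ω | openCluster (ω ∩ edgesIn U) o = ↑W} ω * G (rC U s ω)) = a W * g W := by
    intro W hW
    obtain ⟨-, -, hsW⟩ := mem_pockets.1 hW
    have := pocket_sum (U := U) (o := o) hsW w hm G (∅ : Set V)
    simpa only [ind_rD_empty, mul_one] using this
  -- the four expansions
  have i1 : MX = ρ₁ + ∑ W ∈ Pk, a W * x W := by
    rw [hMX, sum_partition w hoU s]
    exact congrArg _ (Finset.sum_congr rfl fun W hW => hterm_x W hW)
  have i2 : MG = ρG + ∑ W ∈ Pk, a W * g W := by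
    rw [hMG, sum_partition w hoU s]
    exact congrArg _ (Finset.sum_congr rfl fun W hW => hterm_g W hW)
  have i3 : ∑ ω, weight w ω * (ind {ξ | (openGraph (ξ ∩ edgesIn U)).Reachable o s ∨
      P (openCluster (ξ ∩ edgesIn U) o)} ω * ind (rD U s X) ω) = ρ₁ + ∑ W ∈ PkP, a W * x W := by
    rw [sum_partition_rF w hoU s P]
    exact congrArg _ (Finset.sum_congr rfl fun W hW => hterm_x W (Finset.mem_filter.1 hW).1)
  have i4 : ∑ ω, weight w ω * (ind {ξ | (openGraph (ξ ∩ edgesIn U)).Reachable o s ∨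
      P (openCluster (ξ ∩ edgesIn U) o)} ω * G (rC U s ω)) = ρG + ∑ W ∈ PkP, a W * g W := by
    rw [sum_partition_rF w hoU s P]
    exact congrArg _ (Finset.sum_congr rfl fun W hW => hterm_g W (Finset.mem_filter.1 hW).1)
  -- signs
  have hMX0 : 0 ≤ MX := Finset.sum_nonneg fun ω _ => mul_nonneg (weight_nonneg hw0 hw1 ω) (ind_nonneg _ _)
  have hMG0 : 0 ≤ MG := Finset.sum_nonneg fun ω _ => mul_nonneg (weight_nonneg hw0 hw1 ω) (hG0 _)
  have ha0 : ∀ W, 0 ≤ a W := fun W =>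
    Finset.sum_nonneg fun ω _ => mul_nonneg (weight_nonneg hw0 hw1 ω) (ind_nonneg _ _)
  have hxW : ∀ W ∈ Pk, MX ≤ x W := fun W hW => by
    obtain ⟨-, -, hsW⟩ := mem_pockets.1 hW
    refine Finset.sum_le_sum fun η _ => mul_le_mul_of_nonneg_left (ind_mono (fun ζ hζ => ?_) η)
      (weight_nonneg hw0 hw1 η)
    rw [← rD_sdiff_sdiff_eq hsW X]
    exact BystanderBHK.rD_subset_rD_sdiff U W s X hζ
  have hgW : ∀ W, g W ≤ MG := fun W =>
    Finset.sum_le_sum fun η _ => mul_le_mul_of_nonneg_left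
      (hG (BystanderBHK.rC_mono_set Finset.sdiff_subset s η)) (weight_nonneg hw0 hw1 η)
  have hterm0 : ∀ W ∈ Pk, 0 ≤ a W * (x W * MG - g W * MX) := fun W hW => by
    refine mul_nonneg (ha0 W) ?_
    have h1 : MX * MG ≤ x W * MG := mul_le_mul_of_nonneg_right (hxW W hW) hMG0
    have h2 : g W * MX ≤ MG * MX := mul_le_mul_of_nonneg_right (hgW W) hMX0
    nlinarith [h1, h2]
  -- the partial sum over the pockets in `P` is at most the complete sum, which vanishes
  have hkey : ∑ W ∈ PkP, a W * (x W * MG - g W * MX) ≤ ∑ W ∈ Pk, a W * (x W * MG - g W * MX) :=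
    Finset.sum_le_sum_of_subset_of_nonneg (Finset.filter_subset _ _) fun W hW _ => hterm0 W hW
  rw [sum_mul_sub, sum_mul_sub] at hkey
  rw [i3, i4]
  have hρ₁ : ρ₁ = MX - ∑ W ∈ Pk, a W * x W := by linarith [i1]
  have hρG : ρG = MG - ∑ W ∈ Pk, a W * g W := by linarith [i2]
  have e : (ρ₁ + ∑ W ∈ PkP, a W * x W) * MG - (ρG + ∑ W ∈ PkP, a W * g W) * MX =
      ((∑ W ∈ PkP, a W * x W) * MG - (∑ W ∈ PkP, a W * g W) * MX) -
        ((∑ W ∈ Pk, a W * x W) * MG - (∑ W ∈ Pk, a W * g W) * MX) := by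
    rw [hρ₁, hρG]; ring
  linarith [e, hkey]

end

end PocketBHK

/-- **Registered sub-goal `stub_pocketDisjoint_k9` of `stub_goodStep` (siege k9): the base case `X ∩ Y = ∅`
of the pocket-augmented BHK inequality** (= `PocketBHK.disj0`, closed form over the BHK2006 finite-sum
framework): for product weights `w` of total mass `1`, `s, o ∈ U`-restricted percolation, every forbidden set
`X`, every pocket predicate `P` and every increasing `G ≥ 0` of the open edge cluster of `s`,
`E[1_F 1{s↮X}] · E[G] ≤ E[1_F G] · P(s↮X)` with `F = {o ↔ s} ∪ {C(o) ∈ P}`. [folklore] -/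
theorem stub_pocketDisjoint_k9 : ∀ (V : Type) [Fintype V] (w : Sym2 V → ℝ), (∀ e, 0 ≤ w e) →
    (∀ e, w e ≤ 1) → ∑ ω, Literature.Probability.Percolation.BHK2006.weight w ω = 1 →
    ∀ (U : Finset V) (s o : V), o ∈ U → ∀ (X : Set V) (P : Set V → Prop) (G : Set (Sym2 V) → ℝ),
    Monotone G → (∀ a, 0 ≤ G a) →
    (∑ ω, Literature.Probability.Percolation.BHK2006.weight w ω *
        (Literature.Probability.Percolation.DecisionTree.ind {ξ : Set (Sym2 V) | (Literature.Probability.Percolation.openGraph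
            (ξ ∩ Literature.Probability.Percolation.BHK2006.edgesIn U)).Reachable o s ∨
          P (Literature.Probability.Percolation.openCluster
            (ξ ∩ Literature.Probability.Percolation.BHK2006.edgesIn U) o)} ω *
          Literature.Probability.Percolation.DecisionTree.ind (Literature.Probability.Percolation.BHK2006.rD U s X) ω)) *
      (∑ ω, Literature.Probability.Percolation.BHK2006.weight w ω *
        G (Literature.Probability.Percolation.BHK2006.rC U s ω)) ≤
    (∑ ω, Literature.Probability.Percolation.BHK2006.weight w ω *
        (Literature.Probability.Percolation.DecisionTree.ind {ξ : Set (Sym2 V) | (Literature.Probability.Percolation.openGraph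
            (ξ ∩ Literature.Probability.Percolation.BHK2006.edgesIn U)).Reachable o s ∨
          P (Literature.Probability.Percolation.openCluster
            (ξ ∩ Literature.Probability.Percolation.BHK2006.edgesIn U) o)} ω *
          G (Literature.Probability.Percolation.BHK2006.rC U s ω))) *
      (∑ ω, Literature.Probability.Percolation.BHK2006.weight w ω *
        Literature.Probability.Percolation.DecisionTree.ind (Literature.Probability.Percolation.BHK2006.rD U s X) ω) :=
  fun _ _ w hw0 hw1 hm _ _ _ hoU X P G hG hG0 => PocketBHK.disj0 w hw0 hw1 hm hoU X P G hG hG0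

end Summit.CriticalPhenomena.PercolationContinuityZ3.Theorems
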